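import Summits.SmoothPoincare4.SmoothPoincare4.Theses.ConvexBisection
import Summits.SmoothPoincare4.SmoothPoincare4.Theses.NoOneHandles
import Summits.SmoothPoincare4.SmoothPoincare4.Theorems.AcyclicBisectionRigidity.Negative.SeamCompatible
import Literature.Geometry.Symplectic.SteinHandlebodies
import Literature.Topology.FourManifolds.CerfGammaFour
import Literature.Topology.FourManifolds.SmoothOrientation
import Literature.Topology.FourManifolds.Gluing
import Literature.Topology.FourManifolds.PropertyRTraceClosing
import Literature.Topology.FourManifolds.Morse
import Literature.Topology.FourManifolds.HomotopySpheres
import Literature.Topology.FourManifolds.HomotopyS4CompactProofs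
import Literature.Topology.FourManifolds.HomotopyS4OrientableProofs
import HarnessLib
import HarnessLib.Audit

/-!
# Line `exchange-recognition` for crux `ConvexBisection.AcyclicBisectionRigidity`
(item stmt-SmoothPoincare4-10507, route `route-SmoothPoincare4-ConvexBisection`, rank 2)

Skeleton (crux-plan, planner-cruxplan-stmt-SmoothPoincare4-10507-exchange-recognition-0, 2026-08-16) of
the round-2 card `Cruxes/AcyclicBisectionRigidity/Ideas/exchange-recognition.md` ("cross-cancellation
across the seam: the 1-handles of one half are the 2-handles of the other"), reshaped by TRIAGE-r2-1/2/3
(all `pass`; merges: seam-duality-cancellation's `w = 1 + Property R` is the `n ≤ 1` module below,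
cork-collapse-doubles' dot-swap lemma (O2) is the paper engine of the lever; doubles are DELEGATED to
crux 4 / item 3717 as every triager and the cdisprove demanded) and by the standing disprover's
`Disproof.lean` gen 5 (§12b three-sector decomposition = the shape of the composition; §13b: exchange
lemma, `M_Hayden ≅ S⁴`, `Σ_P ≅ S⁴` correct; §5d (d): the `Y(p)` family is the `n = 1` instance).

THE CRUX (fixed). For every Hausdorff second-countable `C^∞` 4-manifold `M ≃ₕ S⁴`: an acyclic
common-contact Stein bisection `M = e₁(W₁) ∪ e₂(W₂)` (compact Stein halves, smooth embeddings
covering `M` and meeting exactly along the images of their boundaries, equal pushed-forward complex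
tangencies on the seam, both halves ℚ-acyclic in positive degrees) forces `M ≅ S⁴`.

THE LINE (six registered stubs; composition `AcyclicBisectionRigidity_of`, kernel-checked, no
`sorry` of its own; two sorry-free CROSS-LINKS certify the delegations).

Read the glued sphere through the seam as ONE handle structure: `M = [h⁰ ∪ n₁ h¹ ∪ n₁ h²]_{W₁}
∪ [n₂ h² (along the transported Legendrian duals of W₂'s 2-handles) ∪ n₂ h³ ∪ h⁴]_{W̄₂}`.

* `stub_steinHandleNormalForm` (KNOWN modulo vendoring; L) — a half of such a bisection is a
  BALANCED 2-handlebody: an adapted Morse function with indices `≤ 2`, one index-0 point and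
  `#index 1 = #index 2 =: n` (Eliashberg/Gompf 1998 Thm 1.3 (a) = tree fact
  `Gompf1998_thm13_indexLE_two`; halves of a Stein bisection of a connected `M` are connected
  (Disproof §8 (iii), the `H₀` bookkeeping); Milnor's 0/1-cancellation; `χ(W) = 1` from
  ℚ-acyclicity).
* `stub_crossCancellation` — THE LEVER (exchange normal form, typed through its invariant
  consequence; XL).  In the NON-DOUBLE sectors (the seam map `e₂⁻¹ ∘ e₁|∂W₁` extends to no
  diffeomorphism `W₁ → W₂`: cork-twist ∪ non-twin sectors of `crux_iff_threeSectors`) the `n₁`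
  one-handles of `W₁` are cancelled, after 2-handle slides, by the dual 2-handles of `W₂`, so `M`
  admits a Morse function WITHOUT index-1 critical points and with exactly `n₂` index-2 points
  (`n₂` = the number of 1-handles of the other half; the composition orients the bisection so that
  `n₂ = min(n₁, n₂)`).  Paper engine: (E1) the EXCHANGE / DOT-SWAP lemma (Disproof §13b, triage
  (O2): `{A•,B⁰} ∪_id {A⁰,B•}‾ ≅ S⁴`, dot-swap pairs glue to doubles by disc trading) — every
  in-print inhabitant of the non-twin sector (Hayden arXiv:2003.13681) and every symmetric cork
  twist is an exchange pair, `w = 1` with MERIDIAN duals; (E2) `w = 1` on the rational Mazur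
  family `X_p ∪_{τ_p} X̄_p`, seams `Y(p) ⊇ S³/Q₈` (Disproof §5d (d)); (E3, NEW, line card §Engine)
  PLANAR CROSS-CANCELLATION: for `Σ(F,F′)` over a common planar page the transported duals are the
  `F′`-cycles on pages with framing `pf + 1`, the 1-handles of `P_k × D²` are dotted VERTICAL
  circles whose meridians are the `∂ᵢ`-parallel cycles, and a SHELLABLE type multiset (some cycle
  of type `{i₁}`, some other of type `⊂ {i₁,i₂}` containing `i₂`, …) cancels all `k − 1`
  one-handles and leaves an UNLINK — the cdisprove's `k = 5` witness `Σ(F,F′)` (§13c, types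
  `{234,123,134,3} ∪ {23,1234,34,13}`) and its explicit T6 instance (§13d) are shellable, hence
  predicted STANDARD.  SPC4-implied as typed (a standard sphere carries a height function
  stabilised by `n₂` cancelling 2/3 pairs), so unrefutable short of an exotic `S⁴`; silent on
  doubles by hypothesis (there the duals are parallels of `W`'s own 2-handles: Andrews–Curtis).
* `stub_propertyRClosing` (KNOWN; L) — a homotopy 4-sphere with a Morse function without index-1
  points and AT MOST ONE index-2 point is `S⁴`: one minimum; `c₂ = 0` ⇒ twisted sphere ⇒ Cerf
  `Γ₄ = 0` (`cerf_twistedSphere_four`); `c₂ = 1` ⇒ `M = X_m(K) ∪ (S¹ × B³)`, `S³_m(K) ≅ S¹ × S²`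
  ⇒ `m = 0`, `K` = unknot (Gabai, `isUnknot_of_isIntegralSurgery_zero`) ⇒ `S² × D² ∪ S¹ × B³ ≅ S⁴`
  (Laudenbach–Poénaru, `exists_diffeomorph_comp_incl_eq`).  This closes, GIVEN the lever, every
  bisection ONE of whose halves is a ball or a rational Mazur manifold (`n ≤ 1`: `X_p`, all
  `(1;1;1)` corks, KOU, positron, Oba's `X_n`, Gompf's `C(r,s;m)`).  Shares its mathematics with
  crux 4's registered `stub_propertyRClosing` (line property-r-mazur-halves) but is stated on `M`.
* `stub_gscClosing` (OPEN residual; open-problem) — the same with `≥ 2` index-2 points: Weak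
  Generalised Property R = item stmt-SmoothPoincare4-0377 `NoohGscStandard` of route NoOneHandles
  in unbundled form (cross-link `gscClosing_of_nooh` PROVES it from that item by name).  Through
  the exchange normal form the residual R-link is the 0-framed unlink BY CONSTRUCTION (exchange
  lemma), so the paper route of this line never invokes GPRC; the typed stub forgets the diagram
  (no Kirby-diagram carrier in the tree: definition request filed, see line card) and is therefore
  stated at Weak-GPRC strength.  `Literature.Barriers.SmoothPoincare4.StrictPropertyTwoRBarrier`
  bites HERE and only here.
* `stub_doubleHalfContractible` (KNOWN on paper, Disproof §12 informal theorem; M) — if a double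
  `D(W)` of a compact ℚ-acyclic `W` is a homotopy 4-sphere then `W` is contractible (fold
  retraction `π₁W ↪ π₁D(W) = 1`, duality kills `H₂`, Whitehead).
* `stub_contractibleSteinDoubles` (OPEN residual = the `ψ = id` slice of crux 4 = presentation
  spheres, item 3717 in Stein clothing; open-problem) — doubles of compact contractible Stein
  domains are `S⁴`.  Cross-link `contractibleSteinDoubles_of_crux4` PROVES it from the route's
  rank-4 crux `ContractibleTwistedDoubleStandard` (stmt-SmoothPoincare4-3546) in one line
  (`Negative.double_standard_of_crux`), so this sector is already staffed.
* `AcyclicBisectionRigidity_of` — excluded middle on seam-compatibility (landed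
  `Negative.isDouble_of_seamCompatible`): doubles go through the last two stubs; otherwise normal
  forms of both halves (stub 1 twice, symmetric data), the lever applied towards the half with
  fewer 1-handles, and the closing split `c₂ ≤ 1` / `c₂ ≥ 2`.

DISPROOF USED (`Cruxes/AcyclicBisectionRigidity/Disproof.lean` gen 5 v17 + landed `Negative/*`).
`false_without_homotopyEquiv`: `M ≃ₕ S⁴` is used by the lever (no 1-handles forces `π₁ = 1`), by
both closing stubs and by `stub_doubleHalfContractible` (simple connectivity of the double);
`collapse_without_acyclic`: acyclicity enters stub 1 (balanced counts) and the double stubs;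
`crux_iff_threeSectors` (landed): the composition IS this decomposition — DoubleSector ⇐ stubs
5–6, CorkTwist ∧ NonTwin ⇐ stubs 1–4; §13a (`DoubleReduction` is a costume): honoured — no stub
concludes "`M` is a double / a presentation sphere"; §13b: the typed first lemma
`complementRecognition` (landed, a tree theorem) is NOT a stub, the exchange lemma and
`M_H ≅ S⁴`, `Σ_P ≅ S⁴` are instances of stubs 2–4 with a visibly trivial residual; §5d (d) is
stubs 2+3 verbatim for `M_p`; §13c–d: the line PREDICTS the `k = 5` witness and the 324 T6
spheres standard whenever shellable (engine E3; census job for the cdisprove/lead); §12 informal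
theorem = stub 5 (credited); §4b presentation spheres ⊂ stub 6 — not claimed easy.  No landed
`Negative/` lemma refutes a stub (`not_crux_without_homotopyEquiv`, `not_crux_without_cover`,
`not_crux_without_contractible` all keep hypotheses every stub keeps); negatives index: 0.
-/

noncomputable section

open scoped Manifold ContDiff Topology ContinuousMap
open Set Function
open Literature.Geometry.Symplectic Literature.AlgebraicTopology.SingularHomology
  Literature.Topology.FourManifolds CategoryTheory.Limits

-- The namespace is prescribed by the crux protocol (`Summit.<P>.<Sub>.Cruxes.<Crux>.<Slug>` with
-- `P = Sub = SmoothPoincare4`), hence the duplicated component.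
set_option linter.dupNamespace false
set_option linter.unusedVariables false

namespace Summit.SmoothPoincare4.SmoothPoincare4.Cruxes.AcyclicBisectionRigidity.ExchangeRecognition

open Summit.SmoothPoincare4.SmoothPoincare4.Theses
open Summit.SmoothPoincare4.SmoothPoincare4.Theorems.AcyclicBisectionRigidity.Negative
  (isDouble_of_seamCompatible)
open Summit.SmoothPoincare4.SmoothPoincare4.Theorems.ContractibleTwistedDoubleStandard.Negative
  (double_standard_of_crux)

/-- Local notation: the round 4-sphere with its Mathlib manifold structure. -/
local notation "𝕊⁴" => (Metric.sphere (0 : EuclideanSpace ℝ (Fin 5)) 1)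

/-- Local notation: the model space `ℝ⁴`. -/
local notation "E4" => EuclideanSpace ℝ (Fin 4)

/-! ## Fact-stub G — Gompf 1998 Thm 1.3 (a): compact Stein domains are 2-handlebodies (NAMED-FACT DEBT) -/

/-- **Fact-stub G (`stub_factGompf`; NAMED-FACT DEBT).**  VERBATIM the tree's named fact
`Literature.Geometry.Symplectic.Gompf1998_thm13_indexLE_two` (`SteinHandlebodies.lean`; Gompf
1998 Thm 1.3 (a) / Eliashberg 1990: a compact Stein domain carries a Morse function adapted to
its boundary with all indices `≤ 2`).  Lead reshape r1 (2026-08-16, after wave 1): Stub 1 is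
PROVED conditionally on exactly this fact (worker file, 386 lines, rc 0), so the fact is filed as
its own registered stub instead of hiding inside a `sorry`; a discharge `…_holds` closes it by
`exact`.  Shared debt with crux 4's line `legendrian-r-knot-rigidity` (`stub_steinTwoHandlebody`).
[cite: Gompf1998, Thm. 1.3 (a)] -/
theorem stub_factGompf : Gompf1998_thm13_indexLE_two := by
  sorry

/-! ## Stub 1 — a half of an acyclic Stein bisection is a balanced 2-handlebody (KNOWN modulo fact-stub G) -/

/-- **Stub 1 (`stub_steinHandleNormalForm`; PROVED modulo fact-stub G by wave-1 worker; size L).**  Under the crux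
hypotheses (unbundled: `M ≃ₕ S⁴`; compact Stein halves `(W₁,J₁)`, `(W₂,J₂)`; smooth embeddings
`e₁, e₂` covering `M` and meeting exactly along the images of their boundaries; matching complex
tangencies on the seam; both halves ℚ-acyclic in positive degrees), the FIRST half `W₁` carries a
Morse function `f` adapted to `∂W₁` (`IsMorseAdapted`: `f ≡ 1` and regular on `∂W₁`, `f < 1`
inside) all of whose critical points have index `≤ 2`, with EXACTLY ONE critical point of index `0`
and AS MANY of index `1` as of index `2` — a balanced handle structure
`W₁ ≅ h⁰ ∪ n h¹ ∪ n h²`.  Paper proof: (i) `(W₁, J₁)` compact Stein ⇒ 2-handlebody — Gompf 1998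
Thm 1.3 (a) / Eliashberg 1990 / Milnor (a generic `J`-convex function is Morse with indices `≤ 2`):
the tree's named fact `Literature.Geometry.Symplectic.Gompf1998_thm13_indexLE_two` gives
`IsHandlebodyOfIndexLE 3 2 W₁`, and `SteinStructure.morseIndex_le_two_of_isMCriticalPt` is proved;
(ii) `W₁` is CONNECTED: each component of a compact Stein domain has connected nonempty boundary
(`H₃(W) = 0` for a 2-handlebody, duality), the seam is `e₁(∂W₁) = e₂(∂W₂)`, and `M` (path
connected, `pathConnectedSpace_of_homotopyEquiv`) is the union — so the component matching is a
single pair (Disproof §8 (iii), the `H₀` bookkeeping still open formally); (iii) connected ⇒ all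
but one index-0 point cancel against index-1 points (Milnor 1965 Thm 8.1, smooth cancellation,
adaptedness kept); (iv) `χ(W₁) = c₀ − c₁ + c₂` (handle decomposition) `= b₀ − b₁ + b₂ − … = 1` by
ℚ-acyclicity in positive degrees, so `c₁ = c₂`.  Applied to both halves (the crux data is symmetric).
[cite: Gompf1998, Thm. 1.3 (a)] [cite: MilnorHCobordism1965, Thm. 8.1]
RESHAPE r1 (lead, 2026-08-16): the wave-1 worker proved this from PROVED tree theorems
(`exists_isMorseAdapted_ncard_criticalSetOfIndex_zero_add_one_eq_holds` for the 0/1-cancellation,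
`IsMorseAdapted.finRelHomology_empty` + `FinRelHomology.relEuler_empty_eq_sum` for the χ-count, a
point-set `isPreconnected_of_cover` for the `H₀` step) modulo ONE named fact, Gompf 1998 Thm 1.3(a),
now fed in as the leading hypothesis `hG` and filed as fact-stub G; binder names/notation below are
byte-identical to the worker's file (the gate matches stubs textually). -/
theorem stub_steinHandleNormalForm (hG : Gompf1998_thm13_indexLE_two)
    (M : Type) [TopologicalSpace M] [T2Space M] [SecondCountableTopology M]
    [ChartedSpace (EuclideanSpace ℝ (Fin 4)) M] [IsManifold (𝓡 4) ∞ M]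
    (hM : M ≃ₕ Metric.sphere (0 : EuclideanSpace ℝ (Fin 5)) 1)
    (W₁ : Type) [TopologicalSpace W₁] [ChartedSpace (EuclideanHalfSpace 4) W₁] [IsManifold (𝓡∂ 4) ∞ W₁]
    [CompactSpace W₁] (W₂ : Type) [TopologicalSpace W₂] [ChartedSpace (EuclideanHalfSpace 4) W₂]
    [IsManifold (𝓡∂ 4) ∞ W₂] [CompactSpace W₂] (J₁ : SteinStructure W₁) (J₂ : SteinStructure W₂)
    (e₁ : W₁ → M) (e₂ : W₂ → M)
    (he₁ : Manifold.IsSmoothEmbedding (𝓡∂ 4) (𝓡 4) ∞ e₁)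
    (he₂ : Manifold.IsSmoothEmbedding (𝓡∂ 4) (𝓡 4) ∞ e₂)
    (hcover : range e₁ ∪ range e₂ = univ)
    (_hseam₁ : range e₁ ∩ range e₂ = e₁ '' (𝓡∂ 4).boundary W₁)
    (hseam₂ : range e₁ ∩ range e₂ = e₂ '' (𝓡∂ 4).boundary W₂)
    (_hξ : ∀ w₁ w₂, e₁ w₁ = e₂ w₂ →
      Submodule.map (mfderiv (𝓡∂ 4) (𝓡 4) e₁ w₁).toLinearMap (contactPlane J₁.J w₁) =
      Submodule.map (mfderiv (𝓡∂ 4) (𝓡 4) e₂ w₂).toLinearMap (contactPlane J₂.J w₂))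
    (hac : ∀ k, 0 < k → IsZero (singularHomology ℚ ℚ W₁ k) ∧ IsZero (singularHomology ℚ ℚ W₂ k)) :
    ∃ f : W₁ → ℝ, IsMorseAdapted (𝓡∂ 4) f ∧
      (∀ z, IsMCriticalPt (𝓡∂ 4) f z → morseIndex (𝓡∂ 4) f z ≤ 2) ∧
      (criticalSetOfIndex (𝓡∂ 4) f 0).ncard = 1 ∧
      (criticalSetOfIndex (𝓡∂ 4) f 1).ncard = (criticalSetOfIndex (𝓡∂ 4) f 2).ncard := by
  sorry

/-! ## Stub 2 — THE LEVER: cross-cancellation of the 1-handles across the seam (exchange normal form) -/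

/-- **Stub 2 (`stub_crossCancellation`; THE LEVER; XL).**  Crux data as in Stub 1, plus a balanced
handle normal form `f₂` of the SECOND half (adapted Morse, indices `≤ 2`, one index-0 point,
`n₂ := #index 1 = #index 2`) and the NON-DOUBLE hypothesis: the seam identification
`e₂⁻¹ ∘ e₁ |∂W₁` extends to NO diffeomorphism `W₁ → W₂` (negation of the seam-compatible twin
datum of `Negative.isDouble_of_seamCompatible`; with it `M` is a double of `W₁` and is routed to
stubs 5–6).  Conclusion: `M` carries a Morse function `F` with NO critical point of index `1` and
exactly `n₂` critical points of index `2` — `M` is geometrically simply connected, presented as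
`(𝔻⁴ ∪ n₂ two-handles) ∪ (n₂ three-handles) ∪ 𝔻⁴`.
THE MECHANISM (cross-cancellation = the exchange normal form read invariantly): glue `f₁` (Stub 1
on `W₁`) and `const − f₂` (the second half upside down) to a Morse function on `M` with profile
`(1; n₁; n₁ + n₂; n₂; 1)`; the `n₂` middle 2-handles coming from `W₂` attach to `∂W₁` along the
LEGENDRIAN DUALS `c = ψ⁻¹(belt circles)` of `W₂`'s Weinstein 2-handles (contact `(+1)`-surgery
curves, framing `tb + 1`: Ding–Geiges); CLAIM: after 2-handle slides and isotopy the duals contain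
a complete system of geometric duals of `W₁`'s 1-handles, which therefore cancel
(`(1; n₁; n₁+n₂; n₂; 1) ↦ (1; 0; n₂; n₂; 1)`).  Evidence / engines: (E1) EXCHANGE and DOT-SWAP
pairs `{A•,B⁰} ∪_id {A⁰,B•}‾` (duals = meridians of the dotted circles: Disproof §13b, triage O2)
— Hayden's non-twin inhabitant `Σ₂(B⁴,C) ∪ Σ̄₂(B⁴,C′)` (arXiv:2003.13681 Thm 1.3, `n = 2`) and
all symmetric-link cork twists incl. the positron sphere `Σ_P`; (E2) the rational Mazur family
`X_p ∪_{τ_p} X̄_p`, seams `Y(p) ⊇ S³/Q₈` (`n = 1`; the dual is a Heegaard core: Disproof §5d (d));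
(E3, NEW) PLANAR CROSS-CANCELLATION for `Σ(F,F′)` over a common planar page — the duals are the
`F′`-cycles on pages with framing `pf+1`, the 1-handles of `P_k × D²` are dotted vertical circles
with the `∂ᵢ`-parallel cycles as meridians, and a SHELLABLE type multiset of `F ∪ F′` cancels every
1-handle (line card §Engine): the cdisprove's `k = 5` witness (§13c) and its explicit T6 sphere
(§13d) are shellable.  Why it might fail: a Stein bisection of `S⁴` whose transported duals have
wrapping number `≥ 2` that no slide reduces — first live instances Gompf's infinite-order cork
twists `f^k` (arXiv:1603.05090 Q 2.2) and the non-shellable simply connected planar pairs of the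
§13c census; no contact-geometric mechanism forcing `w = 1` is known (triage r2-1/2/3).  STATUS AS
TYPED: implied by SPC4 (on `S⁴` stabilise a height function by `n₂` cancelling 2/3 pairs), hence
refutable only by an exotic `S⁴`; NOT the crux restated (it asserts a handle structure, and on the
double sector it is deliberately not claimed: there the duals are parallels of `W`'s own 2-handles
and cancellation is the Andrews–Curtis problem).  Honours `false_without_homotopyEquiv`: without
`M ≃ₕ S⁴` the conclusion (`π₁ M = 1`) fails on `D(B_{p,q})`-type gluings.
[cite: DingGeiges2004, §3] [cite: GompfStipsicz1999, §5.4 and §5.5] -/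
theorem stub_crossCancellation
    (M : Type) [TopologicalSpace M] [T2Space M] [SecondCountableTopology M] [ChartedSpace E4 M]
    [IsManifold (𝓡 4) ∞ M] (hM : M ≃ₕ 𝕊⁴)
    (W₁ : Type) [TopologicalSpace W₁] [ChartedSpace (EuclideanHalfSpace 4) W₁] [IsManifold (𝓡∂ 4) ∞ W₁]
    [CompactSpace W₁] (W₂ : Type) [TopologicalSpace W₂] [ChartedSpace (EuclideanHalfSpace 4) W₂]
    [IsManifold (𝓡∂ 4) ∞ W₂] [CompactSpace W₂] (J₁ : SteinStructure W₁) (J₂ : SteinStructure W₂)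
    (e₁ : W₁ → M) (e₂ : W₂ → M)
    (he₁ : Manifold.IsSmoothEmbedding (𝓡∂ 4) (𝓡 4) ∞ e₁)
    (he₂ : Manifold.IsSmoothEmbedding (𝓡∂ 4) (𝓡 4) ∞ e₂)
    (hcover : range e₁ ∪ range e₂ = univ)
    (hseam₁ : range e₁ ∩ range e₂ = e₁ '' (𝓡∂ 4).boundary W₁)
    (hseam₂ : range e₁ ∩ range e₂ = e₂ '' (𝓡∂ 4).boundary W₂)
    (hξ : ∀ w₁ w₂, e₁ w₁ = e₂ w₂ →
      Submodule.map (mfderiv (𝓡∂ 4) (𝓡 4) e₁ w₁).toLinearMap (contactPlane J₁.J w₁) =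
      Submodule.map (mfderiv (𝓡∂ 4) (𝓡 4) e₂ w₂).toLinearMap (contactPlane J₂.J w₂))
    (hac : ∀ k, 0 < k → IsZero (singularHomology ℚ ℚ W₁ k) ∧ IsZero (singularHomology ℚ ℚ W₂ k))
    (f₂ : W₂ → ℝ) (hf₂ : IsMorseAdapted (𝓡∂ 4) f₂)
    (hf₂i : ∀ z, IsMCriticalPt (𝓡∂ 4) f₂ z → morseIndex (𝓡∂ 4) f₂ z ≤ 2)
    (hf₂0 : (criticalSetOfIndex (𝓡∂ 4) f₂ 0).ncard = 1)
    (hf₂b : (criticalSetOfIndex (𝓡∂ 4) f₂ 1).ncard = (criticalSetOfIndex (𝓡∂ 4) f₂ 2).ncard)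
    (hnd : ¬ ∃ Φ : W₁ ≃ₘ⟮𝓡∂ 4, 𝓡∂ 4⟯ W₂, ∀ w, w ∈ (𝓡∂ 4).boundary W₁ → e₂ (Φ w) = e₁ w) :
    ∃ F : M → ℝ, IsMorse (𝓡 4) F ∧ criticalSetOfIndex (𝓡 4) F 1 = ∅ ∧
      (criticalSetOfIndex (𝓡 4) F 2).ncard = (criticalSetOfIndex (𝓡∂ 4) f₂ 1).ncard := by
  sorry

/-! ## Fact-stub C — Cerf's `Γ₄ = 0` (NAMED-FACT DEBT) -/

/-- **Fact-stub C (`stub_factCerf`; NAMED-FACT DEBT).**  VERBATIM the tree's named fact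
`Literature.Topology.FourManifolds.cerf_twistedSphere_four` (`CerfGammaFour.lean`; Cerf 1968: every
twisted sphere `𝔻⁴ ∪_φ 𝔻⁴` is diffeomorphic to `S⁴`; partial proof programme `CerfGammaFour*.lean`,
`Cerf*.lean`).  Lead reshape r2 (2026-08-16): Stub 3 is PROVED conditionally on this fact (its
`c₂ = 0` case is a twisted sphere) and on the gluing form below; the fact is filed as its own
registered stub, shared with crux 4's `stub_factCerf` (item stmt-SmoothPoincare4-3546). A discharge
`cerf_twistedSphere_four_holds` closes it by `exact`. [cite: CerfDiffeoSphere1968, Γ₄ = 0] -/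
theorem stub_factCerf : cerf_twistedSphere_four := by
  sorry

/-! ## Fact-stubs R, L, T — Property R, Laudenbach–Poénaru, the trace bridge (NAMED-FACT DEBT) -/

/-- **Fact-stub R (`stub_factPropertyR`; NAMED-FACT DEBT).**  VERBATIM the tree's named fact
`Literature.Topology.FourManifolds.isUnknot_of_isIntegralSurgery_zero` (spc4.S25, `SurgeryGluck.lean`;
GABAI'S PROPERTY R, Gabai 1987 Cor. 8.3: a knot in `S³` with an integral surgery `≅ S¹ × S²` is the
unknot; reduced in-tree to the genus clause by `isUnknot_of_isIntegralSurgery_zero_of_gabai_of_disc`,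
partial discharge `isUnknot_of_isIntegralSurgery_zero_holds_of`).  Lead reshape r3 (2026-08-16): Stub 3a
is PROVED conditionally on R, L, T (wave-2 worker), so each is filed as its own registered stub; a
discharge `…_holds` closes it by `exact`. [cite: GabaiJDG1987, Cor. 8.3] -/
theorem stub_factPropertyR : Literature.Topology.FourManifolds.isUnknot_of_isIntegralSurgery_zero := by
  sorry

/-- **Fact-stub L (`stub_factLP`; NAMED-FACT DEBT).**  VERBATIM the tree's named fact
`Literature.Topology.FourManifolds.exists_diffeomorph_comp_incl_eq` at universe `0` (spc4.S24 (c),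
`SPC4Handles.lean`; LAUDENBACH–POÉNARU 1972: every self-diffeomorphism of the boundary of a compact
connected orientable 4-dimensional 1-handlebody extends over it; reduced in-tree to Lemma 2, Cerf's
`Γ₄ = 0` and Thm. A in positive genus, `exists_diffeomorph_comp_incl_eq_holds_of`; the genus-1 case
needed here is NOT yet proved). [cite: LaudenbachPoenaruBSMF1972, main theorem] -/
theorem stub_factLP : exists_diffeomorph_comp_incl_eq.{0} := by
  sorry

/-- **Fact-stub T (`stub_factTrace`; NAMED-FACT DEBT).**  VERBATIM the tree's named fact
`Literature.Topology.FourManifolds.exists_framedKnot_of_hasHandleDecomposition_oneZeroOne`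
(`PropertyRTraceClosing.lean`; the TRACE BRIDGE, Kirby 1989 Ch. I §§1–2, Milnor 1963 Thms. 3.1–3.2,
GST 2010 §2: a `(1,0,1)`-handlebody is the trace of a framed knot `(K, n)` in `S³` with boundary the
integral surgery `S³ₙ(K)`, and the `0`-framed unknot closes up to `S⁴`; formally Milnor 3.13 level
surgery + framing normalisation + the model `S⁴ = S² × D² ∪ S¹ × B³`, XL). [cite: GompfScharlemannThompson2010, §2] -/
theorem stub_factTrace : exists_framedKnot_of_hasHandleDecomposition_oneZeroOne := by
  sorry

/-! ## Stub 3a — Property R closes the trace, GLUING FORM (PROVED modulo fact-stubs R, L, T) -/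

/-- **Stub 3a (`stub_propertyRGluing`; KNOWN THEOREM, size L/XL formally).**  A closed smooth
`4`-manifold `X = P ∪_φ V` glued from a compact `P` carrying an adapted Morse function with indices
`≤ 2`, one critical point of index `0`, none of index `1` and one of index `2` (a knot trace
`X_n(K) = 𝔻⁴ ∪_K h²`, Milnor 1963 Thm 3.2) and a compact connected orientable `V` carrying an adapted
Morse function with indices `≤ 1` and profile `(1,1)` (`V ≅ S¹ × B³`, UNIQ₄
`nonempty_diffeomorph_of_hasHandleDecomposition_handleCount_one_holds`) is `S⁴`:
`S³_n(K) = ∂P ≅ ∂V = S¹ × S²` forces `n = 0`, GABAI'S PROPERTY R (tree named fact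
`isUnknot_of_isIntegralSurgery_zero`, Gabai 1987 Cor 8.3) makes `K` the unknot, `P ≅ S² × D²`, and
`X ≅ S² × D² ∪_φ S¹ × B³ ≅ S⁴` for every `φ` by LAUDENBACH–POÉNARU (tree named facts
`exists_diffeomorph_comp_incl_eq` / `nonempty_diffeomorph_of_isBoundaryGluing_twoHandlebody`) — the
case `n = 1` of Gompf–Scharlemann–Thompson 2010 Prop 9.2.  VERBATIM the registered stub
`stub_propertyRClosing` of crux 4's line `property-r-mazur-halves` (item stmt-SmoothPoincare4-3546),
so ONE proof serves both cruxes (lead reshape r2, 2026-08-16: the wave-1 worker proved Stub 3 from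
the PROVED Morse bookkeeping on the closed manifold modulo Cerf and exactly this gluing form; the
missing formal bridge is `∂(𝔻⁴ ∪_K h²)` as an `IsIntegralSurgery` on `K` plus the
`S² × D² ∪ S¹ × B³ = S⁴` model).  No barrier (Property (1)R is a theorem).
RESHAPE r3 (lead, 2026-08-16): PROVED by the wave-2 worker (343 lines, rc 0) modulo exactly the three
named facts R, L, T fed in as leading hypotheses (fact-stubs above): Morse data ⇒
`HasHandleDecomposition` (1,0,1)/(1,1); the Property-R half of the tree's `PropertyRTraceClosing.lean`
(`H₁ ⇒ n = 0`, then R; the surgery presentation transported to Mathlib's `S² × S¹` across models);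
GST Prop 9.2 for one 2-handle (`nonempty_diffeomorph_sphere_of_isBoundaryGluing_oneTwoHandle_of_facts`)
with UNIQ₄ and L; the fourth leaf `∂(S¹ × B³) = S² × S¹` is the tree THEOREM
`nonempty_diffeomorph_boundary_sphereTwo_prod_of_handleCount_one_one_holds`; header byte-identical
to the worker's file.
[cite: GompfScharlemannThompson2010, Prop. 9.2 (proof), case n = 1] [cite: GabaiJDG1987, Cor. 8.3]
[cite: LaudenbachPoenaruBSMF1972, main theorem] -/
theorem stub_propertyRGluing
    (hPR : Literature.Topology.FourManifolds.isUnknot_of_isIntegralSurgery_zero)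
    (hLP : exists_diffeomorph_comp_incl_eq.{0})
    (hT : exists_framedKnot_of_hasHandleDecomposition_oneZeroOne) :
    ∀ (P : Type) [TopologicalSpace P] [T2Space P] [SecondCountableTopology P]
      [ChartedSpace (EuclideanHalfSpace 4) P] [IsManifold (𝓡∂ 4) ∞ P] [CompactSpace P] (g : P → ℝ),
      IsMorseAdapted (𝓡∂ 4) g →
      (∀ z, IsMCriticalPt (𝓡∂ 4) g z → morseIndex (𝓡∂ 4) g z ≤ 2) →
      (criticalSetOfIndex (𝓡∂ 4) g 0).ncard = 1 → criticalSetOfIndex (𝓡∂ 4) g 1 = ∅ →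
      (criticalSetOfIndex (𝓡∂ 4) g 2).ncard = 1 →
      ∀ (V : Type) [TopologicalSpace V] [T2Space V] [SecondCountableTopology V]
      [ChartedSpace (EuclideanHalfSpace 4) V] [IsManifold (𝓡∂ 4) ∞ V] [CompactSpace V] [ConnectedSpace V],
      (∃ f : V → ℝ, IsMorseAdapted (𝓡∂ 4) f ∧
          (∀ z, IsMCriticalPt (𝓡∂ 4) f z → morseIndex (𝓡∂ 4) f z ≤ 1) ∧
          (criticalSetOfIndex (𝓡∂ 4) f 0).ncard = 1 ∧ (criticalSetOfIndex (𝓡∂ 4) f 1).ncard = 1) →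
      IsOrientable (𝓡∂ 4) V →
      ∀ (bP : BoundaryData (𝓡∂ 4) P (𝓡 3)) (bV : BoundaryData (𝓡∂ 4) V (𝓡 3))
        (φ : bP.carrier ≃ₘ⟮𝓡 3, 𝓡 3⟯ bV.carrier)
        (X : Type) [TopologicalSpace X] [T2Space X] [SecondCountableTopology X] [CompactSpace X]
      [ChartedSpace (EuclideanSpace ℝ (Fin 4)) X] [IsManifold (𝓡 4) ∞ X],
      IsBoundaryGluing bP bV φ (𝓡 4) X →
      Nonempty (X ≃ₘ⟮𝓡 4, 𝓡 4⟯ Metric.sphere (0 : EuclideanSpace ℝ (Fin 5)) 1) := by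
  sorry

/-! ## Stub 3 — closing with at most one surviving 2-handle: Property R (PROVED modulo fact-stub C and Stub 3a) -/

/-- **Stub 3 (`stub_propertyRClosing`; known; size L).**  A homotopy 4-sphere `M` carrying a
Morse function `F` with NO index-1 critical point and AT MOST ONE index-2 critical point is
diffeomorphic to `S⁴`.  Paper proof: `M` is compact and connected
(`compactSpace_of_homotopyEquiv_sphere_four_holds`, `pathConnectedSpace_of_homotopyEquiv`), so the
critical set is finite (`IsMorse.finite_criticalSet_holds`) and, having no index-1 point, `F` has a
unique minimum; rearrange to a self-indexing function (Milnor 1965 Thm 4.8) and cut above the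
2-handles: `M = P ∪_φ V` with `V` a compact connected orientable 1-handlebody (the 3- and 4-handles
upside down; Euler characteristic `χ(M) = 2` and connectivity of `∂P` pin its shape).  If `c₂ = 0`:
`P ≅ 𝔻⁴` (Milnor's disc theorem `nonempty_diffeomorph_closedBall_of_isMorseAdapted_of_isLocalMin`),
`V ≅ 𝔻⁴`, `M` is a twisted sphere, `≅ S⁴` by Cerf `Γ₄ = 0` (`cerf_twistedSphere_four`).  If
`c₂ = 1`: `P = 𝔻⁴ ∪_K h² = X_m(K)` is a knot trace and `V ≅ S¹ × B³`
(`OneHandlebodyClassification`), so `S³_m(K) = ∂P ≅ ∂V = S¹ × S²`, whence `m = 0` (homology) and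
`K` is the unknot (Gabai 1987 Cor. 8.3, tree `isUnknot_of_isIntegralSurgery_zero`), `P ≅ S² × D²`,
and `M ≅ S² × D² ∪_φ S¹ × B³ ≅ S⁴` for every `φ` (Laudenbach–Poénaru 1972, tree
`exists_diffeomorph_comp_incl_eq` / `nonempty_diffeomorph_of_isBoundaryGluing_twoHandlebody`).  The
`n ≤ 1` slice of item stmt-SmoothPoincare4-0377 (`NoOneHandles.NoohGscStandard`), known; same
mathematics as crux 4's registered `stub_propertyRClosing` (line property-r-mazur-halves), here on
`M`.  No barrier: Property (1)R is a theorem.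
[cite: GabaiJDG1987, Cor. 8.3] [cite: LaudenbachPoenaruBSMF1972, main theorem] [cite: CerfDiffeoSphere1968]
RESHAPE r2 (lead, 2026-08-16): PROVED by the wave-1 worker from tree theorems (`exists_isMorse_normalForm`:
one minimum by `exists_isMorse_ncard_criticalSetOfIndex_zero_add_one_eq_holds`, `χ = 2` by
`SphereMorseCount.morseCount_eq_relEuler` + homotopy invariance, turn-about ⇒ profile `(1,c₂,c₂,0,1)`;
`c₂ = 0`: twisted sphere by `IsMorse.exists_isTwistedSphere_of_ncard_criticalSet_eq_two`, then Cerf;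
`c₂ = 1`: self-indexing rearrangement `exists_isSelfIndexing_criticalSet_eq_holds`, cut at `5/2` by
`RegularSublevel.isBoundaryGluing_split`, then the gluing form) modulo the two leading hypotheses
`hC` (fact-stub C) and `hR` (Stub 3a); binder text byte-identical to the worker's file. -/
theorem stub_propertyRClosing (hC : cerf_twistedSphere_four)
    (hR : ∀ (P : Type) [TopologicalSpace P] [T2Space P] [SecondCountableTopology P]
      [ChartedSpace (EuclideanHalfSpace 4) P] [IsManifold (𝓡∂ 4) ∞ P] [CompactSpace P] (g : P → ℝ),
      IsMorseAdapted (𝓡∂ 4) g →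
      (∀ z, IsMCriticalPt (𝓡∂ 4) g z → morseIndex (𝓡∂ 4) g z ≤ 2) →
      (criticalSetOfIndex (𝓡∂ 4) g 0).ncard = 1 → criticalSetOfIndex (𝓡∂ 4) g 1 = ∅ →
      (criticalSetOfIndex (𝓡∂ 4) g 2).ncard = 1 →
      ∀ (V : Type) [TopologicalSpace V] [T2Space V] [SecondCountableTopology V]
      [ChartedSpace (EuclideanHalfSpace 4) V] [IsManifold (𝓡∂ 4) ∞ V] [CompactSpace V] [ConnectedSpace V],
      (∃ f : V → ℝ, IsMorseAdapted (𝓡∂ 4) f ∧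
          (∀ z, IsMCriticalPt (𝓡∂ 4) f z → morseIndex (𝓡∂ 4) f z ≤ 1) ∧
          (criticalSetOfIndex (𝓡∂ 4) f 0).ncard = 1 ∧ (criticalSetOfIndex (𝓡∂ 4) f 1).ncard = 1) →
      IsOrientable (𝓡∂ 4) V →
      ∀ (bP : BoundaryData (𝓡∂ 4) P (𝓡 3)) (bV : BoundaryData (𝓡∂ 4) V (𝓡 3))
        (φ : bP.carrier ≃ₘ⟮𝓡 3, 𝓡 3⟯ bV.carrier)
        (X : Type) [TopologicalSpace X] [T2Space X] [SecondCountableTopology X] [CompactSpace X]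
      [ChartedSpace (EuclideanSpace ℝ (Fin 4)) X] [IsManifold (𝓡 4) ∞ X],
      IsBoundaryGluing bP bV φ (𝓡 4) X →
      Nonempty (X ≃ₘ⟮𝓡 4, 𝓡 4⟯ Metric.sphere (0 : EuclideanSpace ℝ (Fin 5)) 1))
    (M : Type) [TopologicalSpace M] [T2Space M] [SecondCountableTopology M] [ChartedSpace E4 M]
    [IsManifold (𝓡 4) ∞ M] (hM : M ≃ₕ 𝕊⁴)
    (F : M → ℝ) (hF : IsMorse (𝓡 4) F) (h1 : criticalSetOfIndex (𝓡 4) F 1 = ∅)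
    (h2 : (criticalSetOfIndex (𝓡 4) F 2).ncard ≤ 1) :
    Nonempty (M ≃ₘ⟮𝓡 4, 𝓡 4⟯ 𝕊⁴) := by
  sorry

/-! ## Stub 4 — closing with ≥ 2 surviving 2-handles: the geometrically-simply-connected residual (OPEN) -/

/-- **Stub 4 (`stub_gscClosing`; OPEN residual; open-problem).**  A homotopy 4-sphere carrying a
Morse function without index-1 critical points and with AT LEAST TWO index-2 critical points is
`S⁴`.  This is Weak Generalised Property R (Gompf–Scharlemann–Thompson 2010 Prop. 9.2: SPC4 for
geometrically simply connected homotopy spheres) = item stmt-SmoothPoincare4-0377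
`NoOneHandles.NoohGscStandard` in unbundled form, restricted to `c₂ ≥ 2`; the cross-link
`gscClosing_of_nooh` below derives it from that item BY NAME, so provers hold it as
`blocked-on: stmt-SmoothPoincare4-0377` unless they exploit the exchange structure.  Role in THIS
line: through the exchange / dot-swap normal form the residual `n₂`-component R-link is the
0-framed UNLINK by construction (exchange lemma, Disproof §13b: "not even Property R is needed"),
so the line's paper route for Hayden's `n = 2` inhabitant and for shellable planar pairs never
invokes GPRC; the typed stub forgets the diagram (gap G-Kirby: no dotted-circle carrier in the tree
— definition request filed by this seat, see the line card) and is therefore stated at Weak-GPRC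
strength.  Why it might fail: an exotic geometrically simply connected homotopy 4-sphere (GST's
`L_{n,1}` spheres are standard; Meier–Zupan R-links; none known exotic); SPC4-implied, refutable
only by an exotic `S⁴`.  Barrier: `Literature.Barriers.SmoothPoincare4.StrictPropertyTwoRBarrier`
bites exactly here (Property 2R would trivialise AC-hard presentations) — the honest price of
typing the exchange form invariantly.
[cite: GompfScharlemannThompson2010, Prop. 9.2] [cite: Kirby1997, Problems 4.18 and 1.82] -/
theorem stub_gscClosing
    (M : Type) [TopologicalSpace M] [T2Space M] [SecondCountableTopology M] [ChartedSpace E4 M]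
    [IsManifold (𝓡 4) ∞ M] (hM : M ≃ₕ 𝕊⁴)
    (F : M → ℝ) (hF : IsMorse (𝓡 4) F) (h1 : criticalSetOfIndex (𝓡 4) F 1 = ∅)
    (h2 : 1 < (criticalSetOfIndex (𝓡 4) F 2).ncard) :
    Nonempty (M ≃ₘ⟮𝓡 4, 𝓡 4⟯ 𝕊⁴) := by
  sorry

/-! ## Stub 5 — LANDED (p89382); kept verbatim (sorried) until the farm has built the landed module

`Summit.SmoothPoincare4.SmoothPoincare4.Theorems.AcyclicBisectionRigidity.ExchangeRecognition.stub_doubleHalfContractible`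
(tree `Theorems/ConvexBisectionAcyclicBisectionRigidityStubDoubleHalfContractible.lean`, wave 1,
accepted after review 2026-08-16T07:42Z): fold retraction ⇒ `π₁ W = 1` and `H_k(W) ↪ H_k(S⁴) = 0`,
`∂W ≠ ∅` connected (mod-2 Lefschetz), then the tree's recognition theorem
`contractibleSpace_of_isZero_singularHomology_of_boundary_connected` (m = 2).  The import of that
module replaces the `sorry` below at the next re-registration (reshape r2). -/

/-- **Stub 5 (`stub_doubleHalfContractible`; known on paper = Disproof §12 informal theorem; M).**
If `W` is a compact smooth 4-manifold with boundary, ℚ-acyclic in positive degrees, and some double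
`P = W ∪_id W` (`Literature.Topology.FourManifolds.IsDouble b (𝓡 4) P`) is a homotopy 4-sphere,
then `W` is CONTRACTIBLE.  Paper proof: `P` connected forces `W` connected; `H₁(W,∂W;ℚ) ≅ H³(W;ℚ)
= 0` forces `∂W` connected and nonempty; the fold map `P → W` is a retraction, so
`π₁ W ↪ π₁ P = 1`; then `H₁ W = 0`, `tors H₂ W ≅ tors H₁(W,∂W) = 0` (universal coefficients +
Lefschetz duality; `H₁(W,∂W) = 0` by the exact sequence with `∂W` connected), `rank H₂ W = 0` by
ℚ-acyclicity, `H₃ W ≅ H¹(W,∂W) = 0`, `H₄ W = 0`; a simply connected compact manifold with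
vanishing reduced homology is contractible (Hurewicz + Whitehead; `W` has the homotopy type of a
finite CW complex).  No Stein structure is needed.  Consequence used in the composition: the
DOUBLE SECTOR of the crux (`crux_iff_threeSectors` (1)) is the contractible double sector, i.e.
crux 4's `ψ = id` slice (Stub 6). [cite: HatcherAT2002, Thm. 4.5 and Cor. 4.33] -/
theorem stub_doubleHalfContractible
    (W : Type) [TopologicalSpace W] [T2Space W] [SecondCountableTopology W]
    [ChartedSpace (EuclideanHalfSpace 4) W] [IsManifold (𝓡∂ 4) ∞ W] [CompactSpace W]
    (hac : ∀ k, 0 < k → IsZero (singularHomology ℚ ℚ W k))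
    (b : BoundaryData (𝓡∂ 4) W (𝓡 3))
    (P : Type) [TopologicalSpace P] [T2Space P] [SecondCountableTopology P] [ChartedSpace E4 P]
    [IsManifold (𝓡 4) ∞ P] (hD : IsDouble b (𝓡 4) P) (hP : P ≃ₕ 𝕊⁴) :
    ContractibleSpace W := by
  sorry

/-! ## Stub 6 — doubles of contractible Stein domains are `S⁴` (OPEN residual = crux 4's `ψ = id` slice) -/

/-- **Stub 6 (`stub_contractibleSteinDoubles`; OPEN residual; open-problem).**  Every (Hausdorff,
second countable, smooth) double `P = W ∪_id W` of a compact CONTRACTIBLE Stein domain `(W, S)` is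
diffeomorphic to `S⁴`.  (Such `P` is automatically a homotopy 4-sphere; on paper `P = ∂(W × I)`
with `W × I` a contractible 5-dimensional 2-handlebody — Gompf 1998 Thm 1.3 handle structure of
`W` — i.e. a PRESENTATION SPHERE, so this stub is the slice common to item
stmt-SmoothPoincare4-3717 `ConvexityLadder.PresentationSpheresStandard` and to the `ψ = id` sector of
the route's rank-4 crux `ContractibleTwistedDoubleStandard` (stmt-SmoothPoincare4-3546); the
cross-link `contractibleSteinDoubles_of_crux4` below PROVES it from crux 4 in one line, so the
sector is staffed there — this line does not attack it: the lever is silent on doubles, where the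
duals are parallels of `W`'s own 2-handles and cancellation is the Andrews–Curtis problem.)  Known:
Andrews–Curtis-trivial presentations, the Akbulut–Kirby/Gompf family (Gompf 1991), Mazur-type `W`
(`n = 1`: the parallel dual reduces to a geometric dual by free reduction — Mazur 1961 in handle
language).  Why it might fail: one exotic presentation sphere `∂H⁵(𝒫)` kills it, crux 4, 3717 and
SPC4 at once; none believed.  SPC4-implied.
[cite: Gompf1991Killing] [cite: AndrewsCurtis1965] -/
theorem stub_contractibleSteinDoubles
    (W : Type) [TopologicalSpace W] [ChartedSpace (EuclideanHalfSpace 4) W] [IsManifold (𝓡∂ 4) ∞ W]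
    [CompactSpace W] [ContractibleSpace W] (S : SteinStructure W) (b : BoundaryData (𝓡∂ 4) W (𝓡 3))
    (P : Type) [TopologicalSpace P] [T2Space P] [SecondCountableTopology P] [ChartedSpace E4 P]
    [IsManifold (𝓡 4) ∞ P] (hD : IsDouble b (𝓡 4) P) :
    Nonempty (P ≃ₘ⟮𝓡 4, 𝓡 4⟯ 𝕊⁴) := by
  sorry

/-! ## Cross-links (sorry-free): the two open residuals are EXISTING items -/

/-- **Stub 6 follows from the route's rank-4 crux `ContractibleTwistedDoubleStandard`
(stmt-SmoothPoincare4-3546)** — the landed `Negative.double_standard_of_crux` (doubles of compact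
Stein domains are Stein bisections, `steinBisection_of_isDouble`).  So the double sector of this
line is already staffed as crux 4; a proof there discharges Stub 6 by `exact`. -/
theorem contractibleSteinDoubles_of_crux4 (h4 : ConvexBisection.ContractibleTwistedDoubleStandard)
    (W : Type) [TopologicalSpace W] [ChartedSpace (EuclideanHalfSpace 4) W] [IsManifold (𝓡∂ 4) ∞ W]
    [CompactSpace W] [ContractibleSpace W] (S : SteinStructure W) (b : BoundaryData (𝓡∂ 4) W (𝓡 3))
    (P : Type) [TopologicalSpace P] [T2Space P] [SecondCountableTopology P] [ChartedSpace E4 P]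
    [IsManifold (𝓡 4) ∞ P] (hD : IsDouble b (𝓡 4) P) :
    Nonempty (P ≃ₘ⟮𝓡 4, 𝓡 4⟯ 𝕊⁴) :=
  double_standard_of_crux h4 W S b P hD

/-- **Stubs 3 ∧ 4 follow from item stmt-SmoothPoincare4-0377 `NoOneHandles.NoohGscStandard`**
(route NoOneHandles' crux, Weak Generalised Property R, bundled over `HomotopySphere 4`): package
`M` — compact (`compactSpace_of_homotopyEquiv_sphere_four_holds`) and orientable
(`isOrientable_of_homotopyEquiv_sphere_four_holds`, both PROVED tree facts) — as a `HomotopySphere 4`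
and apply the item.  So Stub 4 is `blocked-on: stmt-SmoothPoincare4-0377` in the ledger's sense,
unless proved through the exchange structure. -/
theorem gscClosing_of_nooh (h : NoOneHandles.NoohGscStandard)
    (M : Type) [TopologicalSpace M] [T2Space M] [SecondCountableTopology M] [ChartedSpace E4 M]
    [IsManifold (𝓡 4) ∞ M] (hM : M ≃ₕ 𝕊⁴)
    (F : M → ℝ) (hF : IsMorse (𝓡 4) F) (h1 : criticalSetOfIndex (𝓡 4) F 1 = ∅) :
    Nonempty (M ≃ₘ⟮𝓡 4, 𝓡 4⟯ 𝕊⁴) := by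
  haveI : CompactSpace M := compactSpace_of_homotopyEquiv_sphere_four_holds M hM
  obtain ⟨o⟩ := isOrientable_of_homotopyEquiv_sphere_four_holds M hM
  exact h ⟨M, o, ⟨hM⟩⟩ F hF h1

/-! ## The composition (kernel-checked, no `sorry` of its own) -/

/-- **The composition: the six stubs prove the crux `ConvexBisection.AcyclicBisectionRigidity` BY
NAME** (`sorryAx` enters only through `stub_*`).  Excluded middle on the seam-compatible twin datum
(`∃ Φ : W₁ ≅ W₂` which along `∂W₁` IS the seam identification): if it exists, `M` is an `IsDouble`
of `W₁` (landed `Negative.isDouble_of_seamCompatible`, boundary datum from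
`nonempty_boundaryData_holds`), `W₁` is contractible by Stub 5, and Stub 6 concludes; otherwise
Stub 1 gives balanced handle normal forms of BOTH halves (the crux data is symmetric: swap
`(W₁,J₁,e₁) ↔ (W₂,J₂,e₂)`; the non-double hypothesis transfers through `Φ.symm` and
`Diffeomorph.preimage_boundary`), the lever Stub 2 is applied TOWARDS THE HALF WITH FEWER 1-HANDLES
(so the surviving 2-handles number `min(n₁, n₂)`), and the closing splits as `c₂ ≤ 1` (Stub 3,
known) / `c₂ ≥ 2` (Stub 4, the open residual). -/
theorem AcyclicBisectionRigidity_of : ConvexBisection.AcyclicBisectionRigidity := by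
  intro M _ _ _ _ _ hM hb
  obtain ⟨W₁, _, _, _, _, W₂, _, _, _, _, J₁, J₂, e₁, e₂, he₁, he₂, hcover, hseam₁, hseam₂, hξ, hac⟩ := hb
  by_cases hs : ∃ Φ : W₁ ≃ₘ⟮𝓡∂ 4, 𝓡∂ 4⟯ W₂, ∀ w, w ∈ (𝓡∂ 4).boundary W₁ → e₂ (Φ w) = e₁ w
  · -- DOUBLE SECTOR: seam-compatible twins present `M` as a double of `W₁` (stubs 5, 6)
    obtain ⟨Φ, hΦ⟩ := hs
    haveI : T2Space W₁ := he₁.isEmbedding.t2Space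
    haveI : SecondCountableTopology W₁ := he₁.isEmbedding.secondCountableTopology
    obtain ⟨b⟩ := nonempty_boundaryData_holds 3 W₁
    have hD : IsDouble b (𝓡 4) M := isDouble_of_seamCompatible he₁ he₂ hcover hseam₁ Φ hΦ b
    haveI : ContractibleSpace W₁ :=
      stub_doubleHalfContractible W₁ (fun k hk => (hac k hk).1) b M hD hM
    exact stub_contractibleSteinDoubles W₁ J₁ b M hD
  · -- NON-DOUBLE SECTORS (cork-twist ∪ non-twin): cross-cancellation, then closing by `c₂`
    -- the crux data is symmetric in the two halves
    have hcover' : range e₂ ∪ range e₁ = univ := by rw [union_comm]; exact hcover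
    have hseam₁' : range e₂ ∩ range e₁ = e₂ '' (𝓡∂ 4).boundary W₂ := by rw [inter_comm]; exact hseam₂
    have hseam₂' : range e₂ ∩ range e₁ = e₁ '' (𝓡∂ 4).boundary W₁ := by rw [inter_comm]; exact hseam₁
    have hξ' : ∀ w₂ w₁, e₂ w₂ = e₁ w₁ →
        Submodule.map (mfderiv (𝓡∂ 4) (𝓡 4) e₂ w₂).toLinearMap (contactPlane J₂.J w₂) =
        Submodule.map (mfderiv (𝓡∂ 4) (𝓡 4) e₁ w₁).toLinearMap (contactPlane J₁.J w₁) :=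
      fun w₂ w₁ h => (hξ w₁ w₂ h.symm).symm
    have hac' : ∀ k, 0 < k → IsZero (singularHomology ℚ ℚ W₂ k) ∧ IsZero (singularHomology ℚ ℚ W₁ k) :=
      fun k hk => ⟨(hac k hk).2, (hac k hk).1⟩
    have hs' : ¬ ∃ Ψ : W₂ ≃ₘ⟮𝓡∂ 4, 𝓡∂ 4⟯ W₁, ∀ w, w ∈ (𝓡∂ 4).boundary W₂ → e₁ (Ψ w) = e₂ w := by
      rintro ⟨Ψ, hΨ⟩
      refine hs ⟨Ψ.symm, fun w hw => ?_⟩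
      have hn : (∞ : WithTop ℕ∞) ≠ 0 := by simp
      have hw' : Ψ.symm w ∈ (𝓡∂ 4).boundary W₂ := by
        have : w ∈ Ψ.symm ⁻¹' (𝓡∂ 4).boundary W₂ := by rw [Ψ.symm.preimage_boundary hn]; exact hw
        exact this
      have h := hΨ (Ψ.symm w) hw'
      rw [Ψ.apply_symm_apply] at h
      exact h.symm
    -- balanced handle normal forms of both halves (Stub 1, twice)
    obtain ⟨f₁, hf₁, hf₁i, hf₁0, hf₁b⟩ :=
      stub_steinHandleNormalForm stub_factGompf M hM W₁ W₂ J₁ J₂ e₁ e₂ he₁ he₂ hcover hseam₁ hseam₂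
        hξ hac
    obtain ⟨f₂, hf₂, hf₂i, hf₂0, hf₂b⟩ :=
      stub_steinHandleNormalForm stub_factGompf M hM W₂ W₁ J₂ J₁ e₂ e₁ he₂ he₁ hcover' hseam₁' hseam₂'
        hξ' hac'
    -- closing a geometrically simply connected homotopy sphere, split by the number of 2-handles
    have finish : ∀ F : M → ℝ, IsMorse (𝓡 4) F → criticalSetOfIndex (𝓡 4) F 1 = ∅ →
        Nonempty (M ≃ₘ⟮𝓡 4, 𝓡 4⟯ 𝕊⁴) := fun F hF h1 => by
      by_cases h2 : (criticalSetOfIndex (𝓡 4) F 2).ncard ≤ 1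
      · exact stub_propertyRClosing stub_factCerf
          (stub_propertyRGluing stub_factPropertyR stub_factLP stub_factTrace) M hM F hF h1 h2
      · exact stub_gscClosing M hM F hF h1 (not_le.mp h2)
    -- the lever, oriented towards the half with fewer 1-handles
    by_cases hle : (criticalSetOfIndex (𝓡∂ 4) f₂ 1).ncard ≤ (criticalSetOfIndex (𝓡∂ 4) f₁ 1).ncard
    · obtain ⟨F, hF, h1, -⟩ := stub_crossCancellation M hM W₁ W₂ J₁ J₂ e₁ e₂ he₁ he₂ hcover hseam₁
        hseam₂ hξ hac f₂ hf₂ hf₂i hf₂0 hf₂b hs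
      exact finish F hF h1
    · obtain ⟨F, hF, h1, -⟩ := stub_crossCancellation M hM W₂ W₁ J₂ J₁ e₂ e₁ he₂ he₁ hcover' hseam₁'
        hseam₂' hξ' hac' f₁ hf₁ hf₁i hf₁0 hf₁b hs'
      exact finish F hF h1

/-! ## What the known stubs buy unconditionally (sorry-free bookkeeping for the lead) -/

/-- **The rational-Mazur / ball sector modulo the lever**: if the lever holds and ONE half of a
non-double bisection has a balanced handle normal form with at most one 1-handle, the crux instance
closes by Stub 3 alone (no open residual).  Recorded to make the census line "n ≤ 1 closed modulo
`stub_crossCancellation`" checkable. -/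
theorem nonDouble_standard_of_lever_of_le_one
    (hL : ∀ (M : Type) [TopologicalSpace M] [T2Space M] [SecondCountableTopology M] [ChartedSpace E4 M]
      [IsManifold (𝓡 4) ∞ M] (_hM : M ≃ₕ 𝕊⁴)
      (W₁ : Type) [TopologicalSpace W₁] [ChartedSpace (EuclideanHalfSpace 4) W₁] [IsManifold (𝓡∂ 4) ∞ W₁]
      [CompactSpace W₁] (W₂ : Type) [TopologicalSpace W₂] [ChartedSpace (EuclideanHalfSpace 4) W₂]
      [IsManifold (𝓡∂ 4) ∞ W₂] [CompactSpace W₂] (J₁ : SteinStructure W₁) (J₂ : SteinStructure W₂)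
      (e₁ : W₁ → M) (e₂ : W₂ → M)
      (_he₁ : Manifold.IsSmoothEmbedding (𝓡∂ 4) (𝓡 4) ∞ e₁)
      (_he₂ : Manifold.IsSmoothEmbedding (𝓡∂ 4) (𝓡 4) ∞ e₂)
      (_hcover : range e₁ ∪ range e₂ = univ)
      (_hseam₁ : range e₁ ∩ range e₂ = e₁ '' (𝓡∂ 4).boundary W₁)
      (_hseam₂ : range e₁ ∩ range e₂ = e₂ '' (𝓡∂ 4).boundary W₂)
      (_hξ : ∀ w₁ w₂, e₁ w₁ = e₂ w₂ →
        Submodule.map (mfderiv (𝓡∂ 4) (𝓡 4) e₁ w₁).toLinearMap (contactPlane J₁.J w₁) =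
        Submodule.map (mfderiv (𝓡∂ 4) (𝓡 4) e₂ w₂).toLinearMap (contactPlane J₂.J w₂))
      (_hac : ∀ k, 0 < k → IsZero (singularHomology ℚ ℚ W₁ k) ∧ IsZero (singularHomology ℚ ℚ W₂ k))
      (f₂ : W₂ → ℝ) (_hf₂ : IsMorseAdapted (𝓡∂ 4) f₂)
      (_hf₂i : ∀ z, IsMCriticalPt (𝓡∂ 4) f₂ z → morseIndex (𝓡∂ 4) f₂ z ≤ 2)
      (_hf₂0 : (criticalSetOfIndex (𝓡∂ 4) f₂ 0).ncard = 1)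
      (_hf₂b : (criticalSetOfIndex (𝓡∂ 4) f₂ 1).ncard = (criticalSetOfIndex (𝓡∂ 4) f₂ 2).ncard)
      (_hnd : ¬ ∃ Φ : W₁ ≃ₘ⟮𝓡∂ 4, 𝓡∂ 4⟯ W₂, ∀ w, w ∈ (𝓡∂ 4).boundary W₁ → e₂ (Φ w) = e₁ w),
      ∃ F : M → ℝ, IsMorse (𝓡 4) F ∧ criticalSetOfIndex (𝓡 4) F 1 = ∅ ∧
        (criticalSetOfIndex (𝓡 4) F 2).ncard = (criticalSetOfIndex (𝓡∂ 4) f₂ 1).ncard)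
    (hR : ∀ (M : Type) [TopologicalSpace M] [T2Space M] [SecondCountableTopology M] [ChartedSpace E4 M]
      [IsManifold (𝓡 4) ∞ M] (_hM : M ≃ₕ 𝕊⁴) (F : M → ℝ) (_hF : IsMorse (𝓡 4) F)
      (_h1 : criticalSetOfIndex (𝓡 4) F 1 = ∅) (_h2 : (criticalSetOfIndex (𝓡 4) F 2).ncard ≤ 1),
      Nonempty (M ≃ₘ⟮𝓡 4, 𝓡 4⟯ 𝕊⁴))
    (M : Type) [TopologicalSpace M] [T2Space M] [SecondCountableTopology M] [ChartedSpace E4 M]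
    [IsManifold (𝓡 4) ∞ M] (hM : M ≃ₕ 𝕊⁴)
    (W₁ : Type) [TopologicalSpace W₁] [ChartedSpace (EuclideanHalfSpace 4) W₁] [IsManifold (𝓡∂ 4) ∞ W₁]
    [CompactSpace W₁] (W₂ : Type) [TopologicalSpace W₂] [ChartedSpace (EuclideanHalfSpace 4) W₂]
    [IsManifold (𝓡∂ 4) ∞ W₂] [CompactSpace W₂] (J₁ : SteinStructure W₁) (J₂ : SteinStructure W₂)
    (e₁ : W₁ → M) (e₂ : W₂ → M)
    (he₁ : Manifold.IsSmoothEmbedding (𝓡∂ 4) (𝓡 4) ∞ e₁)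
    (he₂ : Manifold.IsSmoothEmbedding (𝓡∂ 4) (𝓡 4) ∞ e₂)
    (hcover : range e₁ ∪ range e₂ = univ)
    (hseam₁ : range e₁ ∩ range e₂ = e₁ '' (𝓡∂ 4).boundary W₁)
    (hseam₂ : range e₁ ∩ range e₂ = e₂ '' (𝓡∂ 4).boundary W₂)
    (hξ : ∀ w₁ w₂, e₁ w₁ = e₂ w₂ →
      Submodule.map (mfderiv (𝓡∂ 4) (𝓡 4) e₁ w₁).toLinearMap (contactPlane J₁.J w₁) =
      Submodule.map (mfderiv (𝓡∂ 4) (𝓡 4) e₂ w₂).toLinearMap (contactPlane J₂.J w₂))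
    (hac : ∀ k, 0 < k → IsZero (singularHomology ℚ ℚ W₁ k) ∧ IsZero (singularHomology ℚ ℚ W₂ k))
    (f₂ : W₂ → ℝ) (hf₂ : IsMorseAdapted (𝓡∂ 4) f₂)
    (hf₂i : ∀ z, IsMCriticalPt (𝓡∂ 4) f₂ z → morseIndex (𝓡∂ 4) f₂ z ≤ 2)
    (hf₂0 : (criticalSetOfIndex (𝓡∂ 4) f₂ 0).ncard = 1)
    (hf₂b : (criticalSetOfIndex (𝓡∂ 4) f₂ 1).ncard = (criticalSetOfIndex (𝓡∂ 4) f₂ 2).ncard)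
    (hn : (criticalSetOfIndex (𝓡∂ 4) f₂ 1).ncard ≤ 1)
    (hnd : ¬ ∃ Φ : W₁ ≃ₘ⟮𝓡∂ 4, 𝓡∂ 4⟯ W₂, ∀ w, w ∈ (𝓡∂ 4).boundary W₁ → e₂ (Φ w) = e₁ w) :
    Nonempty (M ≃ₘ⟮𝓡 4, 𝓡 4⟯ 𝕊⁴) := by
  obtain ⟨F, hF, h1, h2⟩ := hL M hM W₁ W₂ J₁ J₂ e₁ e₂ he₁ he₂ hcover hseam₁ hseam₂ hξ hac f₂ hf₂ hf₂i
    hf₂0 hf₂b hnd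
  exact hR M hM F hF h1 (h2 ▸ hn)

end Summit.SmoothPoincare4.SmoothPoincare4.Cruxes.AcyclicBisectionRigidity.ExchangeRecognition

end

-- h21 skeleton audit: the composition concludes the crux by name; sorries only in the registered stubs
-- (reshape r1: fact-stub stub_factGompf; stub_steinHandleNormalForm LANDED conditionally on it and imported;
--  reshape r2: stub_doubleHalfContractible LANDED p89382 and imported; fact-stub stub_factCerf + stub_propertyRGluing
--  (Property R gluing form = crux 4's stub_propertyRClosing verbatim); stub_propertyRClosing conditional on both;
--  reshape r3: fact-stubs stub_factPropertyR/stub_factLP/stub_factTrace; stub_propertyRGluing conditional on them;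
--  LANDED so far: stub_doubleHalfContractible p89382, stub_steinHandleNormalForm p90677, stub_propertyRClosing p91206,
--  stub_factGompf p91551 — kept verbatim here until the farm has built their modules, then imported)
-- buildfix 2026-08-19: `#h21_check_skeleton` lives in HarnessLib.Audit.Check (gate scratch only since the
-- 2026-08-16 Audit split) and does not parse in a tree build; kept as a comment — `ledger skeleton check` re-injects it.
-- #h21_check_skeleton "stmt-SmoothPoincare4-10507" Summit.SmoothPoincare4.SmoothPoincare4.Theses.ConvexBisection.AcyclicBisectionRigidity stub_factGompf stub_steinHandleNormalForm stub_crossCancellation stub_factCerf stub_factPropertyR stub_factLP stub_factTrace stub_propertyRGluing stub_propertyRClosing stub_gscClosing stub_doubleHalfContractible stub_contractibleSteinDoubles
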